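import Mathlib.Analysis.Matrix.Order
import Literature.Probability.LatticeModels.ConformalCovariance
import Literature.Probability.LatticeModels.SphereReflectionPositivity
import HarnessLib

/-!
# Inversion positivity: reflection positivity in the unit sphere with conformal weight `Δ`

Topic `Literature/Probability/LatticeModels`, next to `IsInversionCovariant`
(`ConformalCovariance.lean`); vocabulary requested by route
`CriticalPhenomena/Ising3DConformalLimit/PositivityBegetsConformality` (`defn-IsInversionPositive`,
for `InversionPositiveLimit`, `MoebiusOfInversionPositive`, `PositivityImpliesInversionCovariance`,
which inline the predicate verbatim at `d = 3`).

For a continuum family of `n`-point functions `S : CorrFamily d` and a scaling dimension `Δ`,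
`IsInversionPositive Δ S` is Osterwalder–Schrader (reflection) positivity with the time
reflection replaced by the inversion `ι(y) = y/‖y‖²` in the unit sphere (`EuclideanGeometry.inversion
0 1`) and each reflected insertion weighted by the conformal factor `‖y‖^{-2Δ}` ("radial"
OS positivity): for every finite family `(X_a)_{a<m}` of injective configurations of arbitrary
arities `k_a ≥ 0` in the punctured open unit ball, the real Gram matrix
`M_{ab} = (∏ᵢ ‖X_b i‖^{-2Δ}) · S_{k_a+k_b}(X_a ⊔ ιX_b)` is positive semidefinite
(`Matrix.PosSemidef`: symmetric with nonnegative quadratic form).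

Printed ancestors of the rendering:
* the matrix form of OS positivity — Glimm–Jaffe 1987, §6.1, axiom OS3, eqs. (6.1.8)–(6.1.9):
  "the matrix `M_ij = S{f_i − θf_j}` is positive (eigenvalues `≥ 0`) for every finite sequence";
  the mixed-arity Schwinger-function form `Σ_{j,k} ∫ f̄_j f_k S(θx₁,…,θx_j,y₁,…,y_k) ≥ 0` —
  Montvay–Münster 1994, §1.3.5, eq. (1.82); here the test functions are finite combinations of
  point insertions (legitimate for correlation *functions*), which gives exactly the Gram matrices
  over finite families of configurations of all arities;
* the reflection in the unit sphere with conformal weight — Neeb–Ólafsson 2014 (J. Funct. Anal.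
  266, arXiv:1206.2039), §6.2, proof of Prop. 6.2, display (eq:twistker):
  the kernel twisted by the sphere reflection `σ̃(x) = x/‖x‖²` is `‖x‖^{-s}‖σ̃(x) − y‖^{-s}` up to
  the stereographic factors, and `‖x‖²‖σ̃(x) − y‖² = 1 − 2⟨x,y⟩ + ‖x‖²‖y‖²`; Thm. 6.7: reflection
  positivity of the complementary series for the compression semigroup of the ball. At the `1|1`
  level with `S₂(x,y) = ‖x − y‖^{-2Δ}` our Gram matrix is precisely the Neeb–Ólafsson ball kernel
  `R_{2Δ}` of `SphereReflectionPositivity.lean` (`inversionGram_two_point_riesz`, PROVED);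
* Frank–Lieb 2010 ("inversion positivity" of `‖x − y‖^{-λ}`, `N − 2 ≤ λ < N`) for the name;
  Mack 1975 / Lüscher–Mack 1975 for OS positivity in conformal QFT, where the conformal inversion
  plays the role of the time reflection (radial quantisation) — cited for provenance of the notion
  only (Mack 1975 not held: acq-02637; no theorem number is quoted from it).

Companion API (all elementary, PROVED): unfolding (`isInversionPositive_iff`), symmetry of the
Gram matrix (`IsInversionPositive.inversionGram_comm`), nonnegativity of the quadratic form, of
diagonal entries and of the vacuum entry `S 0` (arity-0 configurations are admissible), closure
under pointwise limits on non-coincident configurations (`IsInversionPositive.of_tendsto`), under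
sums, nonnegative scalars and convex combinations, under the arity rescaling `S n ↦ cⁿ S n`, and
under pointwise (Schur) products with added weights (`IsInversionPositive.mul`, Schur product
theorem `Matrix.PosSemidef.hadamard`).

## References

* J. Glimm, A. Jaffe, *Quantum Physics: A Functional Integral Point of View*, 2nd ed., Springer
  1987, §6.1 axiom OS3, eqs. (6.1.8)–(6.1.9). [`GlimmJaffe1987`]
* I. Montvay, G. Münster, *Quantum Fields on a Lattice*, CUP 1994, §1.3.5 eq. (1.82).
  [`MontvayMunster1994`]
* K.-H. Neeb, G. Ólafsson, *Reflection positivity and conformal symmetry*, J. Funct. Anal. 266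
  (2014) 2174–2224, arXiv:1206.2039, §6.2 Prop. 6.2, §6.3 Thm. 6.7. [`NeebOlafsson2014`]
* R. L. Frank, E. H. Lieb, *Inversion positivity and the sharp Hardy–Littlewood–Sobolev
  inequality*, Calc. Var. PDE 39 (2010) 85–99. [`FrankLieb2010`]
* K. Osterwalder, R. Schrader, *Axioms for Euclidean Green's functions*, Comm. Math. Phys. 31
  (1973) 83–112, axiom (E2). [`OsterwalderSchrader1973`]
* G. Mack, *Osterwalder–Schrader positivity in conformal invariant quantum field theory*, Lecture
  Notes in Physics 37 (1975) 66–91 [`Mack1975`]; M. Lüscher, G. Mack, *Global conformal invariance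
  in quantum field theory*, Comm. Math. Phys. 41 (1975) 203–234 [`LuscherMack1975`].

Not here (deliberately): no claim that any particular family is inversion positive (the route's
crux `InversionPositiveLimit` is an open problem); no Hilbert-space reconstruction; the `1|1`
positivity threshold `Δ ≥ (d−2)/2` lives in `SphereReflectionPositivity*.lean`.
-/

noncomputable section

namespace Literature.Probability.LatticeModels

open EuclideanGeometry Filter Topology
open scoped Matrix

variable {d : ℕ}

/-! ### The radial Osterwalder–Schrader Gram matrix and the predicate -/

/-- The **radial Osterwalder–Schrader Gram matrix** of a correlation family `S` with conformal
weight `Δ` at a finite family `X = (X_a)_{a<m}` of configurations of arities `k_a`: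
`M_{ab} = (∏ᵢ ‖X_b i‖^{-2Δ}) · S_{k_a+k_b}(X_a ⊔ ιX_b)`, `ι = EuclideanGeometry.inversion 0 1`
the inversion in the unit sphere (the `b`-configuration is reflected and carries the conformal
factor). (Glimm–Jaffe 1987, §6.1, eq. (6.1.9), with the time reflection replaced by the sphere
inversion and its conformal weight, Neeb–Ólafsson 2014, §6.2.) [cite: GlimmJaffe1987, §6.1 eq. (6.1.9)] -/
def inversionGram (Δ : ℝ) (S : CorrFamily d) {m : ℕ} (k : Fin m → ℕ)
    (X : (a : Fin m) → Fin (k a) → EuclideanSpace ℝ (Fin d)) : Matrix (Fin m) (Fin m) ℝ :=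
  Matrix.of fun a b : Fin m => (∏ i, ‖X b i‖ ^ (-(2 * Δ))) *
    S (k a + k b) (Fin.append (X a) (fun i => inversion 0 1 (X b i)))

/-- Entries of the radial OS Gram matrix. [folklore] -/
@[simp] theorem inversionGram_apply (Δ : ℝ) (S : CorrFamily d) {m : ℕ} (k : Fin m → ℕ)
    (X : (a : Fin m) → Fin (k a) → EuclideanSpace ℝ (Fin d)) (a b : Fin m) :
    inversionGram Δ S k X a b = (∏ i, ‖X b i‖ ^ (-(2 * Δ))) *
      S (k a + k b) (Fin.append (X a) (fun i => inversion 0 1 (X b i))) :=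
  rfl

/-- **Inversion positivity** (reflection positivity in the unit sphere, radial
Osterwalder–Schrader positivity) of a correlation family `S : CorrFamily d` with conformal weight
(scaling dimension) `Δ`: for every `m`, all arities `k : Fin m → ℕ` (arity `0` allowed) and all
injective configurations `X a : Fin (k a) → ℝ^d` in the punctured open unit ball
(`0 < ‖X a i‖ < 1`), the real matrix
`M_{ab} = (∏ᵢ ‖X_b i‖^{-2Δ}) · S (k a + k b) (Fin.append (X a) (ι ∘ X b))`,
`ι = EuclideanGeometry.inversion 0 1`, is positive semidefinite (`Matrix.PosSemidef` over `ℝ`: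
symmetric with `Σ_{a,b} c_a c_b M_{ab} ≥ 0`). This is the OS positivity matrix condition
(Glimm–Jaffe 1987, §6.1 OS3, eqs. (6.1.8)–(6.1.9); mixed arities as in Montvay–Münster 1994,
eq. (1.82)) for point insertions, with the time reflection replaced by the unit-sphere inversion
weighted by its conformal factor `‖y‖^{-2Δ}` (Neeb–Ólafsson 2014, §6.2–6.3; Frank–Lieb 2010,
"inversion positivity"). It is verbatim the conclusion inlined (at `d = 3`) in the route items
`InversionPositiveLimit`, `MoebiusOfInversionPositive`, `PositivityImpliesInversionCovariance` of
`Summits/CriticalPhenomena/Ising3DConformalLimit/Theses/PositivityBegetsConformality.lean`.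
[cite: GlimmJaffe1987, §6.1 axiom OS3, eqs. (6.1.8)–(6.1.9)] -/
def IsInversionPositive (Δ : ℝ) (S : CorrFamily d) : Prop :=
  ∀ (m : ℕ) (k : Fin m → ℕ) (X : (a : Fin m) → Fin (k a) → EuclideanSpace ℝ (Fin d)),
    (∀ a i, X a i ≠ 0 ∧ ‖X a i‖ < 1) → (∀ a, Function.Injective (X a)) →
      (Matrix.of fun a b : Fin m => (∏ i, ‖X b i‖ ^ (-(2 * Δ))) *
        S (k a + k b) (Fin.append (X a) (fun i => inversion 0 1 (X b i)))).PosSemidef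

/-- Unfolding of `IsInversionPositive` through `inversionGram` (definitional). [folklore] -/
theorem isInversionPositive_iff (Δ : ℝ) (S : CorrFamily d) :
    IsInversionPositive Δ S ↔
      ∀ (m : ℕ) (k : Fin m → ℕ) (X : (a : Fin m) → Fin (k a) → EuclideanSpace ℝ (Fin d)),
        (∀ a i, X a i ≠ 0 ∧ ‖X a i‖ < 1) → (∀ a, Function.Injective (X a)) →
          (inversionGram Δ S k X).PosSemidef :=
  Iff.rfl

/-- The Gram matrix of an inversion-positive family at an admissible family of configurations is
positive semidefinite. [folklore] -/
theorem IsInversionPositive.posSemidef {Δ : ℝ} {S : CorrFamily d} (h : IsInversionPositive Δ S)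
    {m : ℕ} {k : Fin m → ℕ} {X : (a : Fin m) → Fin (k a) → EuclideanSpace ℝ (Fin d)}
    (hX : ∀ a i, X a i ≠ 0 ∧ ‖X a i‖ < 1) (hinj : ∀ a, Function.Injective (X a)) :
    (inversionGram Δ S k X).PosSemidef :=
  h m k X hX hinj

/-! ### The conformal weight and admissible configurations -/

/-- The conformal weight `∏ᵢ ‖xᵢ‖^{-2Δ}` of a configuration avoiding the origin is positive.
[folklore] -/
theorem inversionWeight_pos (Δ : ℝ) {n : ℕ} {x : Fin n → EuclideanSpace ℝ (Fin d)}
    (hx : ∀ i, x i ≠ 0) : 0 < ∏ i, ‖x i‖ ^ (-(2 * Δ)) :=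
  Finset.prod_pos fun i _ => Real.rpow_pos_of_pos (norm_pos_iff.2 (hx i)) _

/-- The unit inversion sends the punctured open unit ball outside the closed unit ball:
`‖ι y‖ = 1/‖y‖ > 1` for `0 < ‖y‖ < 1`. [folklore] -/
theorem one_lt_norm_inversion {y : EuclideanSpace ℝ (Fin d)} (hy : y ≠ 0) (hy1 : ‖y‖ < 1) :
    1 < ‖inversion 0 1 y‖ := by
  have h := dist_inversion_center (0 : EuclideanSpace ℝ (Fin d)) y 1
  rw [dist_zero_right, dist_zero_right, one_pow] at h
  rw [h, lt_div_iff₀ (norm_pos_iff.2 hy), one_mul]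
  exact hy1

/-- For an admissible family (points in the punctured open unit ball, each configuration
injective) every juxtaposition `X_a ⊔ ιX_b` is an injective (non-coincident) configuration: the
two halves are injective (`ι` is injective) and live inside, resp. outside, the unit sphere.
[folklore] -/
theorem append_inversion_injective {m : ℕ} {k : Fin m → ℕ}
    {X : (a : Fin m) → Fin (k a) → EuclideanSpace ℝ (Fin d)}
    (hX : ∀ a i, X a i ≠ 0 ∧ ‖X a i‖ < 1) (hinj : ∀ a, Function.Injective (X a)) (a b : Fin m) :
    Function.Injective (Fin.append (X a) (fun i => inversion 0 1 (X b i))) := by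
  rw [Fin.append_injective_iff]
  refine ⟨hinj a, (inversion_injective (0 : EuclideanSpace ℝ (Fin d)) one_ne_zero).comp (hinj b),
    fun i j h => ?_⟩
  have h1 : ‖X a i‖ < 1 := (hX a i).2
  have h2 : 1 < ‖inversion 0 1 (X b j)‖ := one_lt_norm_inversion (hX b j).1 (hX b j).2
  rw [h] at h1
  exact lt_irrefl _ (h1.trans h2)

/-- Admissible juxtapositions are non-coincident configurations (`NonCoincident`). [folklore] -/
theorem append_inversion_mem_nonCoincident {m : ℕ} {k : Fin m → ℕ}
    {X : (a : Fin m) → Fin (k a) → EuclideanSpace ℝ (Fin d)}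
    (hX : ∀ a i, X a i ≠ 0 ∧ ‖X a i‖ < 1) (hinj : ∀ a, Function.Injective (X a)) (a b : Fin m) :
    Fin.append (X a) (fun i => inversion 0 1 (X b i)) ∈ NonCoincident d (k a + k b) :=
  append_inversion_injective hX hinj a b

/-! ### Elementary consequences: symmetry and nonnegativity -/

/-- **Symmetry half of inversion positivity.** A positive semidefinite real matrix is symmetric,
so for an admissible family `w(X_b) S(X_a ⊔ ιX_b) = w(X_a) S(X_b ⊔ ιX_a)`,
`w(Y) = ∏ᵢ ‖Y i‖^{-2Δ}` — the identity behind "positivity implies inversion covariance".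
[folklore] -/
theorem IsInversionPositive.inversionGram_comm {Δ : ℝ} {S : CorrFamily d}
    (h : IsInversionPositive Δ S) {m : ℕ} {k : Fin m → ℕ}
    {X : (a : Fin m) → Fin (k a) → EuclideanSpace ℝ (Fin d)}
    (hX : ∀ a i, X a i ≠ 0 ∧ ‖X a i‖ < 1) (hinj : ∀ a, Function.Injective (X a)) (a b : Fin m) :
    inversionGram Δ S k X a b = inversionGram Δ S k X b a := by
  simpa only [star_trivial] using ((h.posSemidef hX hinj).isHermitian.apply a b).symm

/-- The symmetry written out: `(∏ᵢ ‖X_b i‖^{-2Δ}) S (X_a ⊔ ιX_b) = (∏ᵢ ‖X_a i‖^{-2Δ}) S (X_b ⊔ ιX_a)`.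
[folklore] -/
theorem IsInversionPositive.weight_mul_append_comm {Δ : ℝ} {S : CorrFamily d}
    (h : IsInversionPositive Δ S) {m : ℕ} {k : Fin m → ℕ}
    {X : (a : Fin m) → Fin (k a) → EuclideanSpace ℝ (Fin d)}
    (hX : ∀ a i, X a i ≠ 0 ∧ ‖X a i‖ < 1) (hinj : ∀ a, Function.Injective (X a)) (a b : Fin m) :
    (∏ i, ‖X b i‖ ^ (-(2 * Δ))) * S (k a + k b) (Fin.append (X a) (fun i => inversion 0 1 (X b i))) =
      (∏ i, ‖X a i‖ ^ (-(2 * Δ))) *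
        S (k b + k a) (Fin.append (X b) (fun i => inversion 0 1 (X a i))) :=
  h.inversionGram_comm hX hinj a b

/-- **Nonnegativity of the radial OS quadratic form**: `Σ_{a,b} c_a c_b M_{ab} ≥ 0`. [folklore] -/
theorem IsInversionPositive.sum_mul_inversionGram_nonneg {Δ : ℝ} {S : CorrFamily d}
    (h : IsInversionPositive Δ S) {m : ℕ} {k : Fin m → ℕ}
    {X : (a : Fin m) → Fin (k a) → EuclideanSpace ℝ (Fin d)}
    (hX : ∀ a i, X a i ≠ 0 ∧ ‖X a i‖ < 1) (hinj : ∀ a, Function.Injective (X a)) (c : Fin m → ℝ) :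
    0 ≤ ∑ a, ∑ b, c a * c b * inversionGram Δ S k X a b := by
  have h0 := (h.posSemidef hX hinj).dotProduct_mulVec_nonneg c
  simp only [dotProduct, Matrix.mulVec, star_trivial, Finset.mul_sum] at h0
  refine h0.trans_eq (Finset.sum_congr rfl fun a _ => Finset.sum_congr rfl fun b _ => ?_)
  ring

/-- Diagonal entries: `S_{2k}(X ⊔ ιX) ≥ 0` for every injective configuration `X` in the punctured
open unit ball (the conformal weight is positive). [folklore] -/
theorem IsInversionPositive.append_self_nonneg {Δ : ℝ} {S : CorrFamily d}
    (h : IsInversionPositive Δ S) {m : ℕ} {k : Fin m → ℕ}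
    {X : (a : Fin m) → Fin (k a) → EuclideanSpace ℝ (Fin d)}
    (hX : ∀ a i, X a i ≠ 0 ∧ ‖X a i‖ < 1) (hinj : ∀ a, Function.Injective (X a)) (a : Fin m) :
    0 ≤ S (k a + k a) (Fin.append (X a) (fun i => inversion 0 1 (X a i))) := by
  have h0 : 0 ≤ inversionGram Δ S k X a a := (h.posSemidef hX hinj).diag_nonneg
  rw [inversionGram_apply] at h0
  exact (mul_nonneg_iff_of_pos_left (inversionWeight_pos Δ fun i => (hX a i).1)).1 h0

/-- **The vacuum entry is nonnegative**: arity-`0` configurations are admissible, and the `1 × 1`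
Gram matrix of the empty configuration is `S 0 (∅)`, so `S 0 ≥ 0`. [folklore] -/
theorem IsInversionPositive.vacuum_nonneg {Δ : ℝ} {S : CorrFamily d}
    (h : IsInversionPositive Δ S) (x : Fin 0 → EuclideanSpace ℝ (Fin d)) : 0 ≤ S 0 x := by
  have h0 := h.append_self_nonneg (m := 1) (k := fun _ => 0) (X := fun _ => x)
    (fun _ i => i.elim0) (fun _ i => i.elim0) 0
  have e : (Fin.append x (fun i => inversion 0 1 (x i)) : Fin 0 → EuclideanSpace ℝ (Fin d)) = x :=
    funext fun i => i.elim0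
  rw [e] at h0
  exact h0

/-! ### The cone is closed: pointwise limits -/

/-- **Inversion positivity is closed under pointwise limits.** If `F j → S` pointwise on
non-coincident (injective) configurations along a nontrivial filter and the `F j` are eventually
inversion positive with weight `Δ`, then so is `S` (limits of positive semidefinite matrices are
positive semidefinite; no rate is needed). [folklore] -/
theorem IsInversionPositive.of_tendsto {ι : Type*} {l : Filter ι} [l.NeBot]
    {F : ι → CorrFamily d} {S : CorrFamily d} {Δ : ℝ}
    (hF : ∀ᶠ j in l, IsInversionPositive Δ (F j))
    (hlim : ∀ (n : ℕ) (x : Fin n → EuclideanSpace ℝ (Fin d)), Function.Injective x →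
      Tendsto (fun j => F j n x) l (𝓝 (S n x))) :
    IsInversionPositive Δ S := by
  rw [isInversionPositive_iff]
  intro m k X hX hinj
  have hconv : ∀ a b, Tendsto (fun j => inversionGram Δ (F j) k X a b) l
      (𝓝 (inversionGram Δ S k X a b)) := fun a b =>
    (hlim _ _ (append_inversion_injective hX hinj a b)).const_mul _
  refine Matrix.PosSemidef.of_dotProduct_mulVec_nonneg ?_ fun c => ?_
  · refine Matrix.IsHermitian.ext fun a b => ?_
    rw [star_trivial]
    refine tendsto_nhds_unique (hconv b a) ((hconv a b).congr' ?_)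
    exact hF.mono fun j hj => hj.inversionGram_comm hX hinj a b
  · have ht : Tendsto (fun j => star c ⬝ᵥ (inversionGram Δ (F j) k X *ᵥ c)) l
        (𝓝 (star c ⬝ᵥ (inversionGram Δ S k X *ᵥ c))) := by
      simp only [dotProduct, Matrix.mulVec]
      exact tendsto_finsetSum _ fun a _ =>
        (tendsto_finsetSum _ fun b _ => (hconv a b).mul_const _).const_mul _
    exact ge_of_tendsto ht (hF.mono fun j hj => (hj.posSemidef hX hinj).dotProduct_mulVec_nonneg c)

/-- Pointwise limits of sequences: if every `F j` is inversion positive and `F j n x → S n x` for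
all injective `x`, then `S` is inversion positive. [folklore] -/
theorem IsInversionPositive.of_tendsto_atTop {F : ℕ → CorrFamily d} {S : CorrFamily d} {Δ : ℝ}
    (hF : ∀ j, IsInversionPositive Δ (F j))
    (hlim : ∀ (n : ℕ) (x : Fin n → EuclideanSpace ℝ (Fin d)), Function.Injective x →
      Tendsto (fun j => F j n x) atTop (𝓝 (S n x))) :
    IsInversionPositive Δ S :=
  IsInversionPositive.of_tendsto (Eventually.of_forall hF) hlim

/-! ### The cone is convex -/

/-- The zero family is inversion positive (for every weight). [folklore] -/
theorem IsInversionPositive.zero (Δ : ℝ) : IsInversionPositive Δ (0 : CorrFamily d) := by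
  intro m k X _ _
  convert Matrix.PosSemidef.zero (n := Fin m) (R := ℝ) using 1
  ext a b
  simp

/-- Sums of inversion-positive families (same weight) are inversion positive. [folklore] -/
theorem IsInversionPositive.add {Δ : ℝ} {S T : CorrFamily d} (hS : IsInversionPositive Δ S)
    (hT : IsInversionPositive Δ T) : IsInversionPositive Δ (S + T) := by
  intro m k X hX hinj
  convert (hS m k X hX hinj).add (hT m k X hX hinj) using 1
  ext a b
  simp [mul_add]

/-- Nonnegative multiples of inversion-positive families are inversion positive. [folklore] -/
theorem IsInversionPositive.smul {Δ : ℝ} {S : CorrFamily d} (hS : IsInversionPositive Δ S)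
    {c : ℝ} (hc : 0 ≤ c) : IsInversionPositive Δ (c • S) := by
  intro m k X hX hinj
  convert (hS m k X hX hinj).smul hc using 1
  ext a b
  simp [mul_left_comm]

/-- **Convexity**: convex (indeed conic) combinations of inversion-positive families with the
same weight are inversion positive. [folklore] -/
theorem IsInversionPositive.convex_comb {Δ : ℝ} {S T : CorrFamily d}
    (hS : IsInversionPositive Δ S) (hT : IsInversionPositive Δ T) {s t : ℝ} (hs : 0 ≤ s)
    (ht : 0 ≤ t) : IsInversionPositive Δ (s • S + t • T) :=
  (hS.smul hs).add (hT.smul ht)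

/-! ### Invariances: arity rescaling and Schur products -/

/-- **Arity rescaling** `S n ↦ cⁿ S n` preserves inversion positivity (any real `c`; the Gram
matrix is conjugated by the diagonal matrix `diag(c^{k_a})`). In particular the normalisation
of the field (`c > 0`) is immaterial. [folklore] -/
theorem IsInversionPositive.pow_mul {Δ : ℝ} {S : CorrFamily d} (hS : IsInversionPositive Δ S)
    (c : ℝ) : IsInversionPositive Δ (fun n x => c ^ n * S n x) := by
  classical
  intro m k X hX hinj
  have h := (hS m k X hX hinj).mul_mul_conjTranspose_same (Matrix.diagonal fun a : Fin m => c ^ k a)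
  convert h using 1
  ext a b
  simp only [Matrix.diagonal_conjTranspose, star_trivial, Matrix.mul_diagonal, Matrix.diagonal_mul,
    Matrix.of_apply, pow_add]
  ring

/-- The conformal weights multiply: `∏ ‖xᵢ‖^{-2(Δ₁+Δ₂)} = ∏ ‖xᵢ‖^{-2Δ₁} · ∏ ‖xᵢ‖^{-2Δ₂}` for a
configuration avoiding the origin. [folklore] -/
theorem inversionWeight_add (Δ₁ Δ₂ : ℝ) {n : ℕ} {x : Fin n → EuclideanSpace ℝ (Fin d)}
    (hx : ∀ i, x i ≠ 0) :
    ∏ i, ‖x i‖ ^ (-(2 * (Δ₁ + Δ₂))) = (∏ i, ‖x i‖ ^ (-(2 * Δ₁))) * ∏ i, ‖x i‖ ^ (-(2 * Δ₂)) := by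
  rw [← Finset.prod_mul_distrib]
  refine Finset.prod_congr rfl fun i _ => ?_
  rw [← Real.rpow_add (norm_pos_iff.2 (hx i))]
  ring_nf

/-- **Schur products add weights.** If `S` is inversion positive with weight `Δ₁` and `T` with
weight `Δ₂`, then the pointwise product family `n, x ↦ S n x · T n x` is inversion positive with
weight `Δ₁ + Δ₂`: its Gram matrices are Hadamard products, positive semidefinite by the Schur
product theorem (`Matrix.PosSemidef.hadamard`). E.g. pairing (Wick) parts inherit positivity from
the two-point function. [folklore] -/
theorem IsInversionPositive.mul {Δ₁ Δ₂ : ℝ} {S T : CorrFamily d} (hS : IsInversionPositive Δ₁ S)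
    (hT : IsInversionPositive Δ₂ T) : IsInversionPositive (Δ₁ + Δ₂) (S * T) := by
  intro m k X hX hinj
  have e : (Matrix.of fun a b : Fin m => (∏ i, ‖X b i‖ ^ (-(2 * (Δ₁ + Δ₂)))) *
      (S * T) (k a + k b) (Fin.append (X a) (fun i => inversion 0 1 (X b i)))) =
      inversionGram Δ₁ S k X ⊙ inversionGram Δ₂ T k X := by
    ext a b
    simp only [Matrix.of_apply, Matrix.hadamard_apply, inversionGram_apply, Pi.mul_apply]
    rw [inversionWeight_add Δ₁ Δ₂ fun i => (hX b i).1]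
    ring
  rw [e]
  exact (hS m k X hX hinj).hadamard (hT m k X hX hinj)

/-! ### The `1|1` level: the Neeb–Ólafsson ball kernel -/

/-- Juxtaposing two one-point configurations: first entry. [folklore] -/
theorem append_one_one_apply_zero {α : Type*} (u v : Fin 1 → α) : Fin.append u v 0 = u 0 := by
  rw [Fin.append_right_eq_snoc]
  exact Fin.snoc_apply_zero _ _

/-- Juxtaposing two one-point configurations: second entry. [folklore] -/
theorem append_one_one_apply_one {α : Type*} (u v : Fin 1 → α) : Fin.append u v 1 = v 0 := by
  rw [Fin.append_right_eq_snoc]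
  exact Fin.snoc_last _ _

/-- **At the `1|1` level inversion positivity is sphere-reflection positivity of the two-point
function.** For single-point configurations `x_a` (arity `1`) and a family whose two-point function
is the Riesz kernel, `S 2 (x, y) = ‖x − y‖^{-2Δ}`, the radial OS Gram matrix is the Neeb–Ólafsson
ball kernel matrix `R_{2Δ}(x_a, x_b) = (1 − 2⟨x_a, x_b⟩ + ‖x_a‖²‖x_b‖²)^{-Δ}`
(`ballKernel`, Neeb–Ólafsson 2014, §6.2, proof of Prop. 6.2). [cite: NeebOlafsson2014, §6.2 (proof of Prop. 6.2, display)] -/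
theorem inversionGram_two_point_riesz {Δ : ℝ} {S : CorrFamily d}
    (hS2 : ∀ z : Fin 2 → EuclideanSpace ℝ (Fin d), S 2 z = ‖z 0 - z 1‖ ^ (-(2 * Δ)))
    {m : ℕ} (x : Fin m → EuclideanSpace ℝ (Fin d)) (hx : ∀ a, x a ≠ 0) (a b : Fin m) :
    inversionGram Δ S (fun _ => 1) (fun a (_ : Fin 1) => x a) a b =
      ballKernel d (2 * Δ) (x a) (x b) := by
  rw [← ballKernel_eq_inversion_form (2 * Δ) (x a) (hx b), inversionGram_apply, Fin.prod_univ_one]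
  congr 1
  refine (hS2 _).trans ?_
  rw [append_one_one_apply_zero, append_one_one_apply_one]

end Literature.Probability.LatticeModels

end
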